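import Summits.MatrixMultiplication.MatrixMultiplication.Theorems.AbelianSTPPCensusIteratedRoom

/-!
# The three-room law with a popularity correction, in any abelian group (cell mm-stpp, theory g12)

One statement behind three of the cell's room inequalities.  Let `G` be an abelian group, `A, B, C ⊂ G` finite non-empty
with `S = A + B + C` DIRECT (`|S| = |A||B||C| = V`, the triple product property of `(A, B, C)`), and let

  `R_A = |(A − A) + (B − C)|`, `R_B = |(B − B) + (C − A)|`, `R_C = |(C − C) + (A − B)|`

be the three U14⁺ rooms.  Then for EVERY difference `g ∈ S − S` (`three_room_law_of_mem_sub`):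

  **`4V ≤ R_A + R_B + R_C + |S ∩ (S + g)|`.**

* `G = ℤ`, `g = max S − min S` (represented once): `4V ≤ ΣR + 1` — the three-room law in `ℤ`
  (`STPPRoomLawInt.three_room_law_int`, p550437; not re-derived here).
* `G` finite, `2V > |G|` (fat regime): `S − S = G` and averaging over `g ≠ 0` gives eng-2 g4's energy rule E3
  (`STPPThreeRoomEnergy.three_room_energy`, `(|G| − 1)(4V − ΣR) ≤ V² − V`; not re-derived here).
* averaging over `g ∈ (S − S) ∖ {0}` in general (`three_room_law_avg`): `(|S − S| − 1)·(4V − ΣR) ≤ V² − V`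
  (subtraction-free form), valid in EVERY abelian group and every regime; with Cauchy–Davenport in `ℤ/p` this is the first
  room law of the cell that speaks in the THIN regime `2V ≤ p` of a finite group, where the energy family is silent:
  **`7V ≤ 2·(R_A + R_B + R_C)` for direct triples in `ℤ/p`, `p` prime, `2V − 1 ≤ p`, `V ≥ 2`** (`seven_mul_le_two_mul_rooms_zmod`).
  (eng-1 g5's exact census finds `ΣR = 4V − 1` at every thin prime row; `⌈7V/2⌉` is what the two-translate argument certifies.)

Proof of the main inequality (ten lines): write `g = (a − a') + (b − b') + (c − c') =: d_A + d_B + d_C`.  Room `A` is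
`(A + B − C) − A ⊇` the two translates by `a, a'`, so `2V ≤ R_A + |W ∩ (W + d_A)|` with `W = A + B − C`, `|W| = V`; SIGN
TRANSFER (eng-2 g4's `STPPThreeRoomEnergy.overlap_neg_add` idea, here `card_overlap_addsub_eq`): for a direct triple
`|W ∩ (W + d)| = |S ∩ (S + d)|` for all `d` (both count box pairs; swap `c ↔ c'`).  Likewise for rooms `B`, `C` with the hosts
`B + C − A`, `C + A − B`.  Super-additivity of overlaps (`STPPIteratedRoom.overlap_add`, twice) gives
`Σ_X |S ∩ (S + d_X)| ≤ 2V + |S ∩ (S + g)|`; sum the three rooms.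

WHAT THIS IS NOT: no `ω` statement; no census number moves (the `ℤ/p` corollary is a necessary condition at PRIME orders in
the thin regime only; composite orders undercut `4V − 1` through subgroups — eng-1 g5 ROOMS-RESULT §4 — and are not
touched); no existence claim; nothing non-abelian.  [original; nearest print: Lev 1996 / Gyarmati–Matolcsi–Ruzsa 2010
(super-additivity family), Cauchy–Davenport; mm-stpp-lit g7 LIT-INDEX N21–N26]
-/

-- single-conjunct summit: the mandated namespace repeats `MatrixMultiplication`.
set_option linter.dupNamespace false

namespace Summit.MatrixMultiplication.MatrixMultiplication.Theorems

namespace STPPRoomLaw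

open Finset
open scoped Pointwise

variable {G : Type*} [AddCommGroup G] [DecidableEq G]

/-! ## Two translates inside a room -/

/-- Two translates inside a room: for `x, x' ∈ X` and any finite `S`, `2|S| ≤ |S − X| + |{w ∈ S : w − (x − x') ∈ S}|`
(`S − x ∪ S − x' ⊆ S − X`; the intersection of the two translates embeds into the overlap set by `u ↦ u + x`). [folklore] -/
theorem two_mul_card_le_card_sub_add_overlap (S X : Finset G) {x x' : G} (hx : x ∈ X) (hx' : x' ∈ X) :
    2 * S.card ≤ (S - X).card + (S.filter (· - (x - x') ∈ S)).card := by
  classical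
  set P : Finset G := S.image (· - x) with hP
  set Q : Finset G := S.image (· - x') with hQ
  have hPc : P.card = S.card := card_image_of_injective _ (sub_left_injective)
  have hQc : Q.card = S.card := card_image_of_injective _ (sub_left_injective)
  have hPs : P ⊆ S - X := by
    intro u hu; rw [hP, mem_image] at hu; obtain ⟨s, hs, rfl⟩ := hu; exact sub_mem_sub hs hx
  have hQs : Q ⊆ S - X := by
    intro u hu; rw [hQ, mem_image] at hu; obtain ⟨s, hs, rfl⟩ := hu; exact sub_mem_sub hs hx'
  have hPQ : (P ∩ Q).card ≤ (S.filter (· - (x - x') ∈ S)).card := by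
    refine card_le_card_of_injOn (· + x) ?_ (fun u _ v _ huv => by simpa using huv)
    intro u hu
    rw [mem_coe, mem_inter, hP, hQ, mem_image, mem_image] at hu
    obtain ⟨⟨s, hs, rfl⟩, s', hs', he⟩ := hu
    rw [mem_coe, mem_filter]
    refine ⟨?_, ?_⟩
    · show s - x + x ∈ S
      rw [sub_add_cancel]; exact hs
    · show s - x + x - (x - x') ∈ S
      have : s - x + x - (x - x') = s' := by rw [← he]; abel
      rw [this]; exact hs'
  have h1 : (P ∪ Q).card ≤ (S - X).card := card_le_card (union_subset hPs hQs)
  have h2 := card_union_add_card_inter P Q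
  omega

/-! ## The box and its signed sums -/

/-- `A + B + C` as the image of the box under `(a,b,c) ↦ a + b + c`. [folklore] -/
theorem add_add_eq_image3 (A B C : Finset G) :
    A + B + C = (A ×ˢ (B ×ˢ C)).image (fun p => p.1 + p.2.1 + p.2.2) := by
  ext x
  simp only [mem_add, mem_image, mem_product, Prod.exists]
  constructor
  · rintro ⟨y, ⟨a, ha, b, hb, rfl⟩, c, hc, rfl⟩
    exact ⟨a, b, c, ⟨ha, hb, hc⟩, rfl⟩
  · rintro ⟨a, b, c, ⟨ha, hb, hc⟩, rfl⟩
    exact ⟨a + b, ⟨a, ha, b, hb, rfl⟩, c, hc, rfl⟩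

/-- `A + B − C` as the image of the box under `(a,b,c) ↦ a + b − c`. [folklore] -/
theorem add_sub_eq_image3 (A B C : Finset G) :
    A + B - C = (A ×ˢ (B ×ˢ C)).image (fun p => p.1 + p.2.1 - p.2.2) := by
  ext x
  simp only [mem_sub, mem_add, mem_image, mem_product, Prod.exists]
  constructor
  · rintro ⟨y, ⟨a, ha, b, hb, rfl⟩, c, hc, rfl⟩
    exact ⟨a, b, c, ⟨ha, hb, hc⟩, rfl⟩
  · rintro ⟨a, b, c, ⟨ha, hb, hc⟩, rfl⟩
    exact ⟨a + b, ⟨a, ha, b, hb, rfl⟩, c, hc, rfl⟩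

/-- Directness `|A + B + C| = |A||B||C|` means `(a,b,c) ↦ a + b + c` is injective on the box. [folklore] -/
theorem injOn_add3_of_card (A B C : Finset G) (hdirect : (A + B + C).card = A.card * B.card * C.card) :
    Set.InjOn (fun p : G × (G × G) => p.1 + p.2.1 + p.2.2) ↑(A ×ˢ (B ×ˢ C)) := by
  rw [add_add_eq_image3] at hdirect
  apply card_image_iff.mp
  rw [hdirect, card_product, card_product, mul_assoc]

omit [DecidableEq G] in
/-- If `a + b + c` is injective on the box then so is `a + b − c` (swap the two `c`-coordinates). [folklore] -/
theorem injOn_addsub3_of_injOn_add3 (A B C : Finset G)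
    (h : Set.InjOn (fun p : G × (G × G) => p.1 + p.2.1 + p.2.2) ↑(A ×ˢ (B ×ˢ C))) :
    Set.InjOn (fun p : G × (G × G) => p.1 + p.2.1 - p.2.2) ↑(A ×ˢ (B ×ˢ C)) := by
  rintro ⟨a, b, c⟩ hx ⟨a', b', c'⟩ hy hxy
  simp only [mem_coe, mem_product] at hx hy
  simp only at hxy
  have hx' : (a, (b, c')) ∈ (A ×ˢ (B ×ˢ C)) := by simp only [mem_product]; exact ⟨hx.1, hx.2.1, hy.2.2⟩
  have hy' : (a', (b', c)) ∈ (A ×ˢ (B ×ˢ C)) := by simp only [mem_product]; exact ⟨hy.1, hy.2.1, hx.2.2⟩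
  have key : a + b + c' = a' + b' + c := by
    calc a + b + c' = (a + b - c) + c + c' := by abel
      _ = (a' + b' - c') + c + c' := by rw [hxy]
      _ = a' + b' + c := by abel
  have := h (mem_coe.mpr hx') (mem_coe.mpr hy') (by simp only; exact key)
  simp only [Prod.mk.injEq] at this
  obtain ⟨rfl, rfl, rfl⟩ := this
  rfl

/-- For a direct triple the signed host `A + B − C` also has `|A||B||C|` elements. [folklore] -/
theorem card_add_sub_of_direct (A B C : Finset G) (hdirect : (A + B + C).card = A.card * B.card * C.card) :
    (A + B - C).card = A.card * B.card * C.card := by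
  rw [add_sub_eq_image3, card_image_of_injOn (injOn_addsub3_of_injOn_add3 A B C (injOn_add3_of_card A B C hdirect)),
    card_product, card_product, mul_assoc]

/-! ## Sign transfer: the overlap counts of `A + B − C` are those of `A + B + C` -/

/-- Overlap elements versus pairs: if `f` is injective on `s` and `W = f(s)`, then
`{w ∈ W : w − g ∈ W}` is equinumerous with the pairs `(x, y) ∈ s × s` with `f x − f y = g`. [folklore] -/
theorem card_filter_image_eq_card_pairs {α : Type*} [DecidableEq α] (s : Finset α) (f : α → G)
    (hf : Set.InjOn f ↑s) (g : G) :
    ((s.image f).filter (fun w => w - g ∈ s.image f)).card =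
      ((s ×ˢ s).filter (fun p => f p.1 - f p.2 = g)).card := by
  symm
  refine card_bij (fun p _ => f p.1) ?_ ?_ ?_
  · intro p hp
    rw [mem_filter, mem_product] at hp
    rw [mem_filter, mem_image, mem_image]
    exact ⟨⟨p.1, hp.1.1, rfl⟩, ⟨p.2, hp.1.2, by rw [← hp.2, sub_sub_cancel]⟩⟩
  · intro p hp q hq hpq
    rw [mem_filter, mem_product] at hp hq
    have h1 : p.1 = q.1 := hf (mem_coe.mpr hp.1.1) (mem_coe.mpr hq.1.1) hpq
    have h2 : p.2 = q.2 := by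
      apply hf (mem_coe.mpr hp.1.2) (mem_coe.mpr hq.1.2)
      have ep : f p.2 = f p.1 - g := by rw [← hp.2, sub_sub_cancel]
      have eq' : f q.2 = f q.1 - g := by rw [← hq.2, sub_sub_cancel]
      rw [ep, eq', hpq]
    exact Prod.ext h1 h2
  · intro w hw
    rw [mem_filter, mem_image, mem_image] at hw
    obtain ⟨⟨x, hx, rfl⟩, y, hy, hyw⟩ := hw
    refine ⟨(x, y), ?_, rfl⟩
    rw [mem_filter, mem_product]
    exact ⟨⟨hx, hy⟩, by simp only; rw [hyw, sub_sub_cancel]⟩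

/-- The coordinate swap `c ↔ c'` matches box pairs with `(a+b−c) − (a'+b'−c') = g` to box pairs with
`(a+b+c') − (a'+b'+c) = g`. [original] -/
theorem card_pairs_swap3 (A B C : Finset G) (g : G) :
    (((A ×ˢ (B ×ˢ C)) ×ˢ (A ×ˢ (B ×ˢ C))).filter
        (fun p => (p.1.1 + p.1.2.1 - p.1.2.2) - (p.2.1 + p.2.2.1 - p.2.2.2) = g)).card =
      (((A ×ˢ (B ×ˢ C)) ×ˢ (A ×ˢ (B ×ˢ C))).filter
        (fun p => (p.1.1 + p.1.2.1 + p.1.2.2) - (p.2.1 + p.2.2.1 + p.2.2.2) = g)).card := by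
  refine card_nbij' (fun p => ((p.1.1, (p.1.2.1, p.2.2.2)), (p.2.1, (p.2.2.1, p.1.2.2))))
    (fun p => ((p.1.1, (p.1.2.1, p.2.2.2)), (p.2.1, (p.2.2.1, p.1.2.2)))) ?_ ?_ ?_ ?_
  · rintro ⟨⟨a, b, c⟩, ⟨a', b', c'⟩⟩ hp
    simp only [mem_coe, mem_filter, mem_product] at hp ⊢
    refine ⟨⟨⟨hp.1.1.1, hp.1.1.2.1, hp.1.2.2.2⟩, hp.1.2.1, hp.1.2.2.1, hp.1.1.2.2⟩, ?_⟩
    rw [← hp.2]; abel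
  · rintro ⟨⟨a, b, c⟩, ⟨a', b', c'⟩⟩ hp
    simp only [mem_coe, mem_filter, mem_product] at hp ⊢
    refine ⟨⟨⟨hp.1.1.1, hp.1.1.2.1, hp.1.2.2.2⟩, hp.1.2.1, hp.1.2.2.1, hp.1.1.2.2⟩, ?_⟩
    rw [← hp.2]; abel
  · rintro ⟨⟨a, b, c⟩, ⟨a', b', c'⟩⟩ _
    rfl
  · rintro ⟨⟨a, b, c⟩, ⟨a', b', c'⟩⟩ _
    rfl

/-- **Sign transfer.**  For a direct triple `A + B + C` in an abelian group and every `g`: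
`|{w ∈ A+B−C : w − g ∈ A+B−C}| = |{s ∈ A+B+C : s − g ∈ A+B+C}|` — the overlap function of the signed host is that of
the sum (cf. `STPPThreeRoomEnergy.overlap_neg_add`, the same idea for `X + Y` versus `−X + Y`). [original] -/
theorem card_overlap_addsub_eq (A B C : Finset G) (hdirect : (A + B + C).card = A.card * B.card * C.card) (g : G) :
    ((A + B - C).filter (fun w => w - g ∈ A + B - C)).card =
      ((A + B + C).filter (fun w => w - g ∈ A + B + C)).card := by
  have h0 := injOn_add3_of_card A B C hdirect
  have h2 := injOn_addsub3_of_injOn_add3 A B C h0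
  rw [add_sub_eq_image3, add_add_eq_image3, card_filter_image_eq_card_pairs _ _ h2 g,
    card_filter_image_eq_card_pairs _ _ h0 g]
  exact card_pairs_swap3 A B C g

/-- Bookkeeping: the room `(A − A) + (B − C)` is the host `A + B − C` minus `A`. [folklore] -/
theorem sub_add_sub_eq_host_sub (A B C : Finset G) : (A - A) + (B - C) = (A + B - C) - A := by
  simp only [sub_eq_add_neg, add_assoc, add_comm, add_left_comm]

/-- **One room.**  For a direct triple and `a, a' ∈ A`:
`2|A||B||C| ≤ |(A − A) + (B − C)| + |{s ∈ S : s − (a − a') ∈ S}|`, `S = A + B + C`. [original] -/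
theorem two_mul_le_room_add_overlap (A B C : Finset G) (hdirect : (A + B + C).card = A.card * B.card * C.card)
    {a a' : G} (ha : a ∈ A) (ha' : a' ∈ A) :
    2 * (A.card * B.card * C.card) ≤ ((A - A) + (B - C)).card +
      ((A + B + C).filter (fun s => s - (a - a') ∈ A + B + C)).card := by
  have h := two_mul_card_le_card_sub_add_overlap (A + B - C) A ha ha'
  rw [card_add_sub_of_direct A B C hdirect, card_overlap_addsub_eq A B C hdirect, ← sub_add_sub_eq_host_sub] at h
  exact h

/-! ## The law -/

/-- **The three-room law with popularity correction (any abelian group).**  For finite non-empty `A, B, C` with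
`S = A + B + C` direct (`|S| = |A||B||C| = V`) and every `g ∈ S − S`:
`4V ≤ |(A − A) + (B − C)| + |(B − B) + (C − A)| + |(C − C) + (A − B)| + |{s ∈ S : s − g ∈ S}|`.
(`ℤ`: `g = max S − min S` gives the three-room law `4V − 1`; finite `G`, `2V > |G|`: averaging gives E3.) [original] -/
theorem three_room_law_of_mem_sub (A B C : Finset G) (hdirect : (A + B + C).card = A.card * B.card * C.card)
    {g : G} (hg : g ∈ (A + B + C) - (A + B + C)) :
    4 * (A.card * B.card * C.card) ≤
      ((A - A) + (B - C)).card + ((B - B) + (C - A)).card + ((C - C) + (A - B)).card +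
        ((A + B + C).filter (fun s => s - g ∈ A + B + C)).card := by
  classical
  -- decompose g = d_A + d_B + d_C along the three letters
  rw [mem_sub] at hg
  obtain ⟨s, hs, s', hs', rfl⟩ := hg
  rw [mem_add] at hs hs'
  obtain ⟨y, hy, c, hc, rfl⟩ := hs
  obtain ⟨y', hy', c', hc', rfl⟩ := hs'
  rw [mem_add] at hy hy'
  obtain ⟨a, ha, b, hb, rfl⟩ := hy
  obtain ⟨a', ha', b', hb', rfl⟩ := hy'
  -- the rotated triples are direct and have the same sum
  have hrotB : B + C + A = A + B + C := by rw [add_comm (B + C) A, ← add_assoc]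
  have hrotC : C + A + B = A + B + C := by rw [add_comm C A, add_right_comm]
  have hdirB : (B + C + A).card = B.card * C.card * A.card := by rw [hrotB, hdirect]; ring
  have hdirC : (C + A + B).card = C.card * A.card * B.card := by rw [hrotC, hdirect]; ring
  -- one inequality per room, all overlaps on the host A + B + C
  have h1 := two_mul_le_room_add_overlap A B C hdirect ha ha'
  have h2 := two_mul_le_room_add_overlap B C A hdirB hb hb'
  have h3 := two_mul_le_room_add_overlap C A B hdirC hc hc'
  rw [hrotB] at h2
  rw [hrotC] at h3
  -- super-additivity twice
  have h4 := STPPIteratedRoom.overlap_add (A + B + C) (a - a') (b - b')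
  have h5 := STPPIteratedRoom.overlap_add (A + B + C) (a - a' + (b - b')) (c - c')
  have hg : a - a' + (b - b') + (c - c') = a + b + c - (a' + b' + c') := by abel
  rw [hg] at h5
  have hV : (A + B + C).card = A.card * B.card * C.card := hdirect
  have e2 : B.card * C.card * A.card = A.card * B.card * C.card := by ring
  have e3 : C.card * A.card * B.card = A.card * B.card * C.card := by ring
  rw [e2] at h2
  rw [e3] at h3
  omega

/-! ## Averaging over the differences of `S` -/

/-- `Σ_{g ∈ S − S} |{s ∈ S : s − g ∈ S}| = |S|²` (every ordered pair of `S` has its difference in `S − S`). [folklore] -/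
theorem sum_overlap_sub_eq_sq (S : Finset G) :
    ∑ g ∈ S - S, (S.filter (· - g ∈ S)).card = S.card ^ 2 := by
  rw [← card_sigma, sq, ← card_product]
  refine card_nbij' (fun x => (x.2, x.2 - x.1)) (fun p => ⟨p.1 - p.2, p.1⟩) ?_ ?_ ?_ ?_
  · intro x hx
    rw [mem_coe, mem_sigma, mem_filter] at hx
    rw [mem_coe, mem_product]
    exact ⟨hx.2.1, hx.2.2⟩
  · intro p hp
    rw [mem_coe, mem_product] at hp
    rw [mem_coe, mem_sigma, mem_filter]
    exact ⟨sub_mem_sub hp.1 hp.2, hp.1, by rw [sub_sub_cancel]; exact hp.2⟩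
  · intro x _
    obtain ⟨g, w⟩ := x
    simp only [sub_sub_cancel]
  · intro p _
    exact Prod.ext rfl (sub_sub_cancel _ _)

/-- Punctured form: `Σ_{g ∈ (S − S) ∖ {0}} |{s ∈ S : s − g ∈ S}| + |S| = |S|²`. [folklore] -/
theorem sum_overlap_sub_erase_zero (S : Finset G) (hS : S.Nonempty) :
    ∑ g ∈ (S - S).erase 0, (S.filter (· - g ∈ S)).card + S.card = S.card ^ 2 := by
  have h0 : (0 : G) ∈ S - S := by
    obtain ⟨s, hs⟩ := hS
    have := sub_mem_sub hs hs
    rwa [sub_self] at this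
  have hf0 : (S.filter (· - (0 : G) ∈ S)).card = S.card := by
    congr 1; ext s; simp only [mem_filter, sub_zero, and_self]
  rw [← sum_overlap_sub_eq_sq S, ← add_sum_erase (S - S) _ h0, hf0, add_comm]

/-- **Averaged three-room law (any abelian group).**  For a direct triple with `V = |A||B||C| ≥ 2`, `S = A + B + C`:
`(|S − S| − 1)·4V ≤ (|S − S| − 1)·(R_A + R_B + R_C) + (V² − V)` — i.e. `(|S − S| − 1)(4V − ΣR) ≤ V² − V` whenever
`ΣR ≤ 4V` (some non-zero difference of `S` is at most average-popular). [original] -/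
theorem three_room_law_avg (A B C : Finset G) (hdirect : (A + B + C).card = A.card * B.card * C.card)
    (hV : 2 ≤ A.card * B.card * C.card) :
    (((A + B + C) - (A + B + C)).card - 1) * (4 * (A.card * B.card * C.card)) ≤
      (((A + B + C) - (A + B + C)).card - 1) *
          (((A - A) + (B - C)).card + ((B - B) + (C - A)).card + ((C - C) + (A - B)).card) +
        ((A.card * B.card * C.card) ^ 2 - A.card * B.card * C.card) := by
  classical
  set S := A + B + C with hSdef
  set V := A.card * B.card * C.card with hVdef
  have hScard : S.card = V := hdirect
  have hSne : S.Nonempty := by rw [← card_pos, hScard]; omega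
  -- a non-zero difference exists since |S| ≥ 2
  have hPne : ((S - S).erase 0).Nonempty := by
    have h1 : 1 < S.card := by rw [hScard]; omega
    obtain ⟨s, hs, s', hs', hne⟩ := one_lt_card.mp h1
    exact ⟨s - s', mem_erase.mpr ⟨sub_ne_zero.mpr hne, sub_mem_sub hs hs'⟩⟩
  -- the least popular non-zero difference
  obtain ⟨g₀, hg₀, hmin⟩ := exists_min_image ((S - S).erase 0) (fun g => (S.filter (· - g ∈ S)).card) hPne
  have hsum := sum_overlap_sub_erase_zero S hSne
  have hle : ((S - S).erase 0).card * (S.filter (· - g₀ ∈ S)).card ≤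
      ∑ g ∈ (S - S).erase 0, (S.filter (· - g ∈ S)).card := by
    rw [← smul_eq_mul]; exact card_nsmul_le_sum _ _ _ hmin
  have h0 : (0 : G) ∈ S - S := by
    obtain ⟨s, hs⟩ := hSne
    have := sub_mem_sub hs hs
    rwa [sub_self] at this
  have hcard : ((S - S).erase 0).card = (S - S).card - 1 := card_erase_of_mem h0
  have hlaw := three_room_law_of_mem_sub A B C hdirect (mem_of_mem_erase hg₀)
  rw [← hSdef] at hlaw
  rw [hcard] at hle
  rw [hScard] at hsum
  -- (D)(4V) ≤ D·ΣR + D·|T_{g₀}| ≤ D·ΣR + (V² − V)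
  have hD : ((S - S).card - 1) * (S.filter (· - g₀ ∈ S)).card ≤ V ^ 2 - V := by omega
  calc ((S - S).card - 1) * (4 * V)
      ≤ ((S - S).card - 1) * (((A - A) + (B - C)).card + ((B - B) + (C - A)).card + ((C - C) + (A - B)).card +
          (S.filter (· - g₀ ∈ S)).card) := Nat.mul_le_mul_left _ hlaw
    _ = ((S - S).card - 1) * (((A - A) + (B - C)).card + ((B - B) + (C - A)).card + ((C - C) + (A - B)).card) +
          ((S - S).card - 1) * (S.filter (· - g₀ ∈ S)).card := by ring
    _ ≤ _ := by omega

/-- **The thin three-room law in `ℤ/p` (two-translate strength).**  `p` prime, `A, B, C ⊂ ℤ/p` with `A + B + C` direct,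
`V = |A||B||C| ≥ 2` and `2V − 1 ≤ p`: **`7V ≤ 2·(|(A−A)+(B−C)| + |(B−B)+(C−A)| + |(C−C)+(A−B)|)`**, i.e. `ΣR ≥ ⌈7V/2⌉`.
(Cauchy–Davenport: `|S − S| ≥ 2V − 1`, so the least popular non-zero difference of `S` has popularity `≤ V/2`.)  A necessary
condition for STPP members at PRIME orders in the regime `2V ≤ p` where the energy rules E3/E3⁺ are silent; the exact
census (eng-1 g5) has `4V − 1` there. [original] -/
theorem seven_mul_le_two_mul_rooms_zmod {p : ℕ} [Fact p.Prime] (A B C : Finset (ZMod p))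
    (hdirect : (A + B + C).card = A.card * B.card * C.card) (hV : 2 ≤ A.card * B.card * C.card)
    (hp : 2 * (A.card * B.card * C.card) - 1 ≤ p) :
    7 * (A.card * B.card * C.card) ≤
      2 * (((A - A) + (B - C)).card + ((B - B) + (C - A)).card + ((C - C) + (A - B)).card) := by
  classical
  set S := A + B + C with hSdef
  set V := A.card * B.card * C.card with hVdef
  have hScard : S.card = V := hdirect
  have hSne : S.Nonempty := by rw [← card_pos, hScard]; omega
  -- Cauchy–Davenport for S − S = S + (−S)
  have hCD : 2 * V - 1 ≤ (S - S).card := by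
    have h := ZMod.cauchy_davenport (Fact.out : p.Prime) hSne hSne.neg
    rw [card_neg, ← sub_eq_add_neg, hScard] at h
    have : min p (V + V - 1) = 2 * V - 1 := by rw [min_eq_right (by omega)]; omega
    omega
  have havg := three_room_law_avg A B C hdirect hV
  rw [← hSdef, ← hVdef] at havg
  -- with D = |S − S| − 1 ≥ 2(V − 1):  D(4V − ΣR) ≤ V(V − 1) ⇒ 2(4V − ΣR) ≤ V
  set R := ((A - A) + (B - C)).card + ((B - B) + (C - A)).card + ((C - C) + (A - B)).card with hRdef
  by_contra hcon
  rw [not_le] at hcon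
  -- 2R < 7V, so 4V − R ≥ 1 and 2(4V − R) ≥ V + 1
  have hR : R < 4 * V := by omega
  have hsq : V ^ 2 - V = V * (V - 1) := by
    rw [sq, Nat.mul_sub_one]
  rw [hsq] at havg
  have hD : 2 * (V - 1) ≤ (S - S).card - 1 := by omega
  -- (2(V-1)) * (4V - R) ≤ D * (4V - R) ≤ V (V - 1)
  have h1 : ((S - S).card - 1) * (4 * V - R) ≤ V * (V - 1) := by
    have : ((S - S).card - 1) * (4 * V) = ((S - S).card - 1) * (4 * V - R) + ((S - S).card - 1) * R := by
      rw [← Nat.mul_add]; congr 1; omega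
    omega
  have h2 : 2 * (V - 1) * (4 * V - R) ≤ V * (V - 1) := le_trans (Nat.mul_le_mul_right _ hD) h1
  have h3 : 2 * (4 * V - R) ≤ V := by
    have hV1 : 0 < V - 1 := by omega
    have : (2 * (4 * V - R)) * (V - 1) ≤ V * (V - 1) := by
      calc (2 * (4 * V - R)) * (V - 1) = 2 * (V - 1) * (4 * V - R) := by ring
        _ ≤ V * (V - 1) := h2
    exact Nat.le_of_mul_le_mul_right this hV1
  omega

/-- Instance check (binary tiling `A = {0,1}`, `B = {0,2}`, `C = {0,4}` read in `ℤ/17`, `V = 8`, `2V − 1 = 15 ≤ 17`):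
the triple is direct and its rooms `9 + 10 + 12 = 31` satisfy `7·8 = 56 ≤ 62 = 2·31` (and in fact `31 = 4V − 1`). -/
example : (({0, 1} : Finset (ZMod 17)) + {0, 2} + {0, 4}).card = 8 ∧
    ((({0, 1} : Finset (ZMod 17)) - {0, 1}) + (({0, 2} : Finset (ZMod 17)) - {0, 4})).card = 9 ∧
    ((({0, 2} : Finset (ZMod 17)) - {0, 2}) + (({0, 4} : Finset (ZMod 17)) - {0, 1})).card = 10 ∧
    ((({0, 4} : Finset (ZMod 17)) - {0, 4}) + (({0, 1} : Finset (ZMod 17)) - {0, 2})).card = 12 := by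
  decide

end STPPRoomLaw

end Summit.MatrixMultiplication.MatrixMultiplication.Theorems
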